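import Summits.QuantumFields.BalabanUV.Beta.EriceRemainderEnclosureHistoryAutonomyComparisonFading
import Summits.QuantumFields.BalabanUV.Beta.EriceRemainderEnclosureHistoryAutonomyComparisonShapeProfileEnd

/-!
# EriceRemainderEnclosureHistoryAutonomyComparisonFadingShape — (E60c) FADING MEMORIES OF A SUB-HOMOGENEOUS SHAPE COMPARE AT ANY SIZE:
# `B(u) = ρ(u_0) + Σ_{k<K} L_k·ψ(u_k)`, `ψ ≥ 0` non-decreasing and sub-homogeneous on ]0,γ] (`s·ψ(x) ≤ ψ(s·x)`, `0 ≤ s ≤ 1`: `min(u,σ)`, `u∕(1+u)`,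
# `log(1+u)`, `u^θ`, …), the profile FADING from age one on (`L_1 ≥ L_2 ≥ …`; `L_0`, `L_1`, `K`, `ρ` and ALL SIZES ARBITRARY): every `B′ ≥ B` with a zeroth
# moment and an ISOTONE excess gives `h′ ≤ h` at every scale from every pin (`le_of_isotone_excess_dom_fading_shape`, `le_of_isotone_excess_fading_shape`,
# `le_of_isotone_excess_fading_min`) — (E60a)'s fading certificate `φ = 𝟙_{0}` with (E59a)'s shape weight at age one

Cell `pub-balaban`, β-function sub-cell, BINDER row D4 «RemainderConst leaves for Bałaban's split» (`HOME/BINDER-OWNERS.md`; owner lineage `b2b-balaban-beta-an4`;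
this file by co-owner #2 lineage `b2b-balaban-beta-d4-p2`, generation 53), β-FLOW TEAM duty (1), FREEZE (0) honoured (def-free; (E60a)'s `sum_le_of_fading`,
(E59a)'s `shape_drop_le` ∕ `shape_weight_le_profile`, (E59b)'s `min_shape_nonneg` ∕ `_mono` ∕ `_subhom` ∕ `_lipschitz`, (E59a)'s `shape_functional_monotone` ∕
`_floor` ∕ `_zerothMoment`, (E58b)'s `profile_pos`, (E58a)'s `le_of_isotone_excess_of_step`, (E49j)'s `excess_shift_le`, (E48a)'s `strictAnti_of_memFlow`, node
U2's `MemFlow` ∕ `seqBox_shift` ∕ `Sharpness.abs_sub_le_half_cube_mul` BY NAME; nothing restated).  Joins (E60a) `…ComparisonFading` (affine fading profiles)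
and (E59a)∕(E59b) `…ComparisonShapeProfile(End)` (shapes under the profile condition `Σ_j L_j∕P_j ≤ 2`).

HONEST FRAMING (page 1, verbatim and binding).  *"Discharging BetaPertH makes Bałaban's UV stability UNCONDITIONAL — a real constructive-QFT result; it is
NOT the continuum limit and NOT the Clay problem."*  THIS FILE DISCHARGES NOTHING OF THE KIND.  Elementary real analysis about ABSTRACT functionals on a box
]0,γ]^ℕ with displayed signs, shapes, domination and moduli — hypotheses of a census, not facts; the form, signs and moments of Bałaban's (1.22) limit
functional (in particular its age profile and shape) are NOT PRINTED ([I] p. 298; GAPS G-t4-U2-1∕-2) and NOT asserted.  Row D4 class UNCHANGED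
(critical-path width 0; instance 0∕1; D4 DISCHARGE NO DATE).  HONEST DEPENDENCY: continuum YM on T⁴ ⇐ BetaPertH ∧ nine spine estimates (0/9 proved);
BetaPertH ⇐ (D1) ∧ (D4) ∧ CAP+tail; G-an2-4 gates asym, D1 and NE2/3/4.

THE POINT (census sense (α); the COMPARISON column).  (E60a)'s argument is about the PROFILE, not the shape: with `G_k = ψ(h_k) − ψ(h′_k) ≥ 0` (`G_0 = 0`),
the drop at the pin is `d₀ ≤ Σ_k L_k·G_k ≤ L_1·G_1 + Σ_k L_k·G_{k+1}` for a fading profile ((E60a) `sum_le_of_fading`), the read one scale deeper is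
`Σ_k L_k·G_{k+1} ≤ d₁` (class hypothesis `hlow`: the shape profile dominates the differences of `B`), and at age one sub-homogeneity gives
`G_1 ≤ ψ(h_1)·(h_1 − h′_1)∕h_1 ≤ (ψ(h_1)·h_1²∕2)·δ₁` ((E59a) `shape_drop_le`, node U2's gap bound) with **`L_1·ψ(h_1)·h_1² ≤ L_1∕P_1 ≤ √2`** along EVERY
trajectory WHATEVER the sizes ((E59a) `shape_weight_le_profile` at age one) — so again `d₀ ≤ δ₁ + d₁ = η₀ ≤ η`.  CONSEQUENCE: saturating ∕ concave-type
fading memories `ρ(u_0) + Σ_k L_k·ψ(u_k)` (`ψ = min(·,σ)`, …) compare at any size under isotone excesses — where (E59a)∕(E59b) needed the profile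
condition (windows of factor `3`, Markov-dominated).  NOT CLAIMED: shapes that are not sub-homogeneous (convex kinks `(u − θ)₊`, for which comparison FAILS at
large size by (E56b)'s sharpness), rising profiles, necessity, anything printed.

WHAT IS PROVED ([folklore]; 0 `def`, 0 sorry).  §1 `mono_of_low_shape`, `shape_weight_one_le_one` (`L_1·ψ(h_1)·h_1²∕2 ≤ 1`).  §2
**`effective_le_of_family_le_at_fading_shape`** (THE STEP).  §3 ENDs **`le_of_isotone_excess_dom_fading_shape`**, **`le_of_isotone_excess_fading_shape`**
(the model `b + Σ_k L_k·ψ(u_k)`, `ψ` `Λ`-Lipschitz), **`le_of_isotone_excess_fading_min`** (`b + Σ_k L_k·min(u_k, σ)`).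
-/
noncomputable section
open Finset Set

namespace Summit.QuantumFields.BalabanUV.Beta.EriceRemainderEnclosureHistoryAutonomyComparisonFadingShape

open Literature.MathematicalPhysics.QuantumFieldTheory.Balaban1983to89
open Literature.MathematicalPhysics.QuantumFieldTheory.Balaban1983to89.T4BetaStationary
open Literature.MathematicalPhysics.QuantumFieldTheory.Balaban1983to89.T4BetaFlowWellPosed
open Literature.MathematicalPhysics.QuantumFieldTheory.Balaban1983to89.T4BetaFlowWellPosed.Sharpness (abs_sub_le_half_cube_mul)
open Summit.QuantumFields.BalabanUV.Beta.EriceRemainderEnclosureHistoryAutonomyOrder (strictAnti_of_memFlow)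
open Summit.QuantumFields.BalabanUV.Beta.EriceRemainderEnclosureHistoryAutonomyComparisonExcess (excess_shift_le)
open Summit.QuantumFields.BalabanUV.Beta.EriceRemainderEnclosureHistoryAutonomyComparisonPrinciple (le_of_isotone_excess_of_step)
open Summit.QuantumFields.BalabanUV.Beta.EriceRemainderEnclosureHistoryAutonomyComparisonAffineProfile (profile_pos)
open Summit.QuantumFields.BalabanUV.Beta.EriceRemainderEnclosureHistoryAutonomyComparisonShapeProfile
  (shape_drop_le shape_weight_le_profile shape_functional_monotone shape_functional_floor shape_functional_zerothMoment)
open Summit.QuantumFields.BalabanUV.Beta.EriceRemainderEnclosureHistoryAutonomyComparisonShapeProfileEnd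
  (min_shape_nonneg min_shape_mono min_shape_subhom min_shape_lipschitz)
open Summit.QuantumFields.BalabanUV.Beta.EriceRemainderEnclosureHistoryAutonomyComparisonFading (sum_le_of_fading)

variable {B B' : (ℕ → ℝ) → ℝ} {M M' γ b y Λ σ : ℝ} {L : ℕ → ℝ} {ψ : ℝ → ℝ} {K : ℕ} {h h' : ℕ → ℝ}

/-! ## §1 The class is isotone; the shape weight of age one -/

/-- A memory whose differences dominate those of the shape profile (`Σ_{k<K} L_k·(ψ(u_k) − ψ(u′_k)) ≤ B u − B u′` for `u′ ≤ u` on the box, `L ≥ 0`,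
`ψ` non-decreasing on ]0,γ]) is ISOTONE. [folklore] -/
theorem mono_of_low_shape (hL : ∀ k, 0 ≤ L k) (hψmono : ∀ x x' : ℝ, 0 < x → x ≤ x' → x' ≤ γ → ψ x ≤ ψ x')
    (hlow : ∀ u u' : ℕ → ℝ, SeqBox γ u → SeqBox γ u' → (∀ j, u' j ≤ u j) →
      ∑ k ∈ range K, L k * (ψ (u k) - ψ (u' k)) ≤ B u - B u') :
    ∀ u v : ℕ → ℝ, SeqBox γ u → SeqBox γ v → (∀ j, u j ≤ v j) → B u ≤ B v := by
  intro u v hu hv huv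
  have h1 := hlow v u hv hu huv
  have h2 : 0 ≤ ∑ k ∈ range K, L k * (ψ (v k) - ψ (u k)) :=
    sum_nonneg fun k _ => mul_nonneg (hL k) (sub_nonneg.mpr (hψmono _ _ (hu k).1 (huv k) (hv k).2))
  linarith

/-- **THE SHAPE WEIGHT OF AGE ONE IS AT MOST ONE**: `L_1·ψ(h_1)·h_1²∕2 ≤ 1` along EVERY box solution from EVERY pin of an isotone memory with floor
`b > 0` dominated by the shape profile (`Σ_k L_k·ψ(u_k) ≤ B u`; `ψ ≥ 0` non-decreasing sub-homogeneous), WHATEVER the sizes — (E59a)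
`shape_weight_le_profile` at age one (`L_1·ψ(h_1)·h_1²·P_1 ≤ L_1`, `P_1 ≥ L_1∕√2 ≥ L_1∕2`). [folklore] -/
theorem shape_weight_one_le_one (hmono : ∀ u v : ℕ → ℝ, SeqBox γ u → SeqBox γ v → (∀ j, u j ≤ v j) → B u ≤ B v) (hL : ∀ k, 0 ≤ L k)
    (hb : 0 < b) (hlo : ∀ u, SeqBox γ u → b ≤ B u) (hdom : ∀ u, SeqBox γ u → ∑ k ∈ range K, L k * ψ (u k) ≤ B u)
    (hψnn : ∀ x : ℝ, 0 < x → x ≤ γ → 0 ≤ ψ x) (hψmono : ∀ x x' : ℝ, 0 < x → x ≤ x' → x' ≤ γ → ψ x ≤ ψ x')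
    (hψsub : ∀ s x : ℝ, 0 ≤ s → s ≤ 1 → 0 < x → x ≤ γ → s * ψ x ≤ ψ (s * x))
    (hy : 0 < y) (hh : SeqBox γ h) (hf : MemFlow B y h) (hK : 1 ∈ range K) : L 1 * (ψ (h 1) * h 1 ^ 2 / 2) ≤ 1 := by
  have h1 := (hh 1).1
  have hψ1 : 0 ≤ ψ (h 1) := hψnn _ h1 (hh 1).2
  rcases (hL 1).eq_or_lt with hL1 | hL1
  · rw [← hL1]; simp
  have hP := profile_pos hL hK le_rfl hL1
  set P : ℝ := ∑ k ∈ range K, L k * Real.sqrt (((1 : ℕ) : ℝ) / (((1 : ℕ) : ℝ) + k)) with hP_def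
  have hw := shape_weight_le_profile hmono hL hb hlo hdom hψnn hψmono hψsub hy hh hf hK
  -- ψ(h 1) h 1² · P ≤ 1
  have h3 : ψ (h 1) * h 1 ^ 2 * P ≤ 1 := by
    have e : L 1 * ((1 : ℕ) : ℝ) * ψ (h 1) * h 1 ^ 2 = L 1 * (ψ (h 1) * h 1 ^ 2) := by simp; ring
    rw [e, le_div_iff₀ hP] at hw
    have : L 1 * (ψ (h 1) * h 1 ^ 2 * P) ≤ L 1 * 1 := by
      rw [mul_one]
      calc L 1 * (ψ (h 1) * h 1 ^ 2 * P) = L 1 * (ψ (h 1) * h 1 ^ 2) * P := by ring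
        _ ≤ L 1 := hw
    exact le_of_mul_le_mul_left this hL1
  -- P ≥ L 1 · √(1/2) ≥ L 1 / 2
  have hs : (1 : ℝ) / 2 ≤ Real.sqrt (((1 : ℕ) : ℝ) / (((1 : ℕ) : ℝ) + ((1 : ℕ) : ℝ))) := by
    have e : (((1 : ℕ) : ℝ) / (((1 : ℕ) : ℝ) + ((1 : ℕ) : ℝ))) = 1 / 2 := by norm_num
    rw [e]
    have hsq := Real.sq_sqrt (show (0 : ℝ) ≤ 1 / 2 by norm_num)
    nlinarith [Real.sqrt_nonneg ((1 : ℝ) / 2)]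
  have hPge : L 1 * (1 / 2) ≤ P := by
    have hsingle : L 1 * Real.sqrt (((1 : ℕ) : ℝ) / (((1 : ℕ) : ℝ) + ((1 : ℕ) : ℝ))) ≤ P := by
      rw [hP_def]
      exact single_le_sum (f := fun k => L k * Real.sqrt (((1 : ℕ) : ℝ) / (((1 : ℕ) : ℝ) + k)))
        (fun k _ => mul_nonneg (hL k) (Real.sqrt_nonneg _)) hK
    exact (mul_le_mul_of_nonneg_left hs hL1.le).trans hsingle
  have h13 : 0 ≤ ψ (h 1) * h 1 ^ 2 := by positivity
  calc L 1 * (ψ (h 1) * h 1 ^ 2 / 2) = ψ (h 1) * h 1 ^ 2 * (L 1 * (1 / 2)) := by ring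
    _ ≤ ψ (h 1) * h 1 ^ 2 * P := mul_le_mul_of_nonneg_left hPge h13
    _ ≤ 1 := h3

/-! ## §2 THE STEP for fading shape profiles -/

/-- **THE STEP FOR FADING MEMORIES OF A SUB-HOMOGENEOUS SHAPE.**  `B` with floor `b > 0` on ]0,γ], dominated by the shape profile (`Σ_{k<K} L_k·ψ(u_k) ≤ B u`),
whose differences dominate those of the profile (`Σ_k L_k·(ψ(u_k) − ψ(u′_k)) ≤ B u − B u′` for `u′ ≤ u`) and are dominated by them at fixed newest entry
(`B u − B u′ ≤ Σ_k L_k·(ψ(u_k) − ψ(u′_k))` for `u′ ≤ u`, `u′_0 = u_0`); `ψ ≥ 0` non-decreasing sub-homogeneous on ]0,γ]; `L ≥ 0` FADING from age one on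
(`L_{k+1} ≤ L_k` for `k ≥ 1`); `B ≤ B′` on the box with ISOTONE excess; `h`, `h′` box solutions of `B`, `B′` from one pin `y` with `h′ ≤ h` at every scale.
Then `B h ≤ B′ h′`: `d₀ ≤ L_1·G_1 + Σ_k L_k·G_{k+1} ≤ L_1·(ψ(h_1)·h_1²∕2)·δ₁ + d₁ ≤ δ₁ + d₁ = η₀ ≤ η`. [folklore] -/
theorem effective_le_of_family_le_at_fading_shape (hL : ∀ k, 0 ≤ L k) (hb : 0 < b) (hlo : ∀ u, SeqBox γ u → b ≤ B u)
    (hdom : ∀ u, SeqBox γ u → ∑ k ∈ range K, L k * ψ (u k) ≤ B u)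
    (hdrop : ∀ u u' : ℕ → ℝ, SeqBox γ u → SeqBox γ u' → (∀ j, u' j ≤ u j) → u' 0 = u 0 →
      B u - B u' ≤ ∑ k ∈ range K, L k * (ψ (u k) - ψ (u' k)))
    (hlow : ∀ u u' : ℕ → ℝ, SeqBox γ u → SeqBox γ u' → (∀ j, u' j ≤ u j) →
      ∑ k ∈ range K, L k * (ψ (u k) - ψ (u' k)) ≤ B u - B u')
    (hψnn : ∀ x : ℝ, 0 < x → x ≤ γ → 0 ≤ ψ x) (hψmono : ∀ x x' : ℝ, 0 < x → x ≤ x' → x' ≤ γ → ψ x ≤ ψ x')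
    (hψsub : ∀ s x : ℝ, 0 ≤ s → s ≤ 1 → 0 < x → x ≤ γ → s * ψ x ≤ ψ (s * x))
    (hfade : ∀ k, 1 ≤ k → L (k + 1) ≤ L k)
    (hexc : ∀ u, SeqBox γ u → B u ≤ B' u)
    (hDmono : ∀ u v : ℕ → ℝ, SeqBox γ u → SeqBox γ v → (∀ j, u j ≤ v j) → B' u - B u ≤ B' v - B v)
    (hy : 0 < y) (hh : SeqBox γ h) (hf : MemFlow B y h) (hh' : SeqBox γ h') (hf' : MemFlow B' y h') (hle : ∀ j, h' j ≤ h j) :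
    B h ≤ B' h' := by
  have hmono := mono_of_low_shape hL hψmono hlow
  have hlo' : ∀ u, SeqBox γ u → b ≤ B' u := fun u hu => (hlo u hu).trans (hexc u hu)
  have hanti' : Antitone h' := (strictAnti_of_memFlow hb hlo' hh' hf').antitone
  set η : ℝ := B' h' - B h' with hη_def
  -- the excess read one scale deeper: η₀ ≤ η
  set η₀ : ℝ := B' (fun j => h' (1 + j)) - B (fun j => h' (1 + j)) with hη₀_def
  have hη₀ : η₀ ≤ η := by
    have := (abs_le.mp (excess_shift_le hexc hDmono hh' hanti' 0)).1
    simp only [zero_add] at this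
    rw [hη₀_def]; linarith
  -- the drop read one scale deeper: d₁, dominated from below by the shape-profile read one age later
  set d₁ : ℝ := B (fun j => h (1 + j)) - B (fun j => h' (1 + j)) with hd₁_def
  have hd₁ : ∑ k ∈ range K, L k * (ψ (h (k + 1)) - ψ (h' (k + 1))) ≤ d₁ := by
    have : ∑ k ∈ range K, L k * (ψ (h (1 + k)) - ψ (h' (1 + k))) ≤ B (fun j => h (1 + j)) - B (fun j => h' (1 + j)) :=
      hlow (fun j => h (1 + j)) (fun j => h' (1 + j)) (seqBox_shift hh 1) (seqBox_shift hh' 1) fun j => hle (1 + j)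
    rw [hd₁_def]
    refine le_trans (le_of_eq (sum_congr rfl fun k _ => ?_)) this
    rw [add_comm k 1]
  -- the level gap at scale one: δ₁ = η₀ − d₁ ≥ 0
  set δ₁ : ℝ := 1 / h' 1 ^ 2 - 1 / h 1 ^ 2 with hδ₁_def
  have hδ₁ : δ₁ = η₀ - d₁ := by
    have e := hf.2 0
    have e' := hf'.2 0
    simp only [zero_add] at e e'
    rw [hf.1] at e
    rw [hf'.1] at e'
    rw [hδ₁_def, hη₀_def, hd₁_def, e, e']
    ring
  have hδ₁0 : 0 ≤ δ₁ :=
    sub_nonneg.mpr (one_div_le_one_div_of_le (pow_pos (hh' 1).1 2) (pow_le_pow_left₀ (hh' 1).1.le (hle 1) 2))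
  -- the coupling gap at scale one: g₁ ≤ (h_1³/2)·δ₁, and the shape gap G₁ ≤ ψ(h_1)·g₁/h_1
  have hg₁ : h 1 - h' 1 ≤ h 1 ^ 3 / 2 * δ₁ := by
    have hw := abs_sub_le_half_cube_mul (hh 1).1 (hh' 1).1 le_rfl (hle 1)
    rw [abs_sub_comm (1 / h 1 ^ 2), ← hδ₁_def, abs_of_nonneg hδ₁0] at hw
    exact (le_abs_self _).trans hw
  have h1 := (hh 1).1
  have hψ1 : 0 ≤ ψ (h 1) := hψnn _ h1 (hh 1).2
  have hG₁ : ψ (h 1) - ψ (h' 1) ≤ ψ (h 1) * h 1 ^ 2 / 2 * δ₁ := by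
    have hd := shape_drop_le (γ := γ) hψsub (hh' 1).1 (hle 1) (hh 1).2
    calc ψ (h 1) - ψ (h' 1) ≤ ψ (h 1) * ((h 1 - h' 1) / h 1) := hd
      _ ≤ ψ (h 1) * ((h 1 ^ 3 / 2 * δ₁) / h 1) := mul_le_mul_of_nonneg_left (div_le_div_of_nonneg_right hg₁ h1.le) hψ1
      _ = ψ (h 1) * h 1 ^ 2 / 2 * δ₁ := by field_simp
  -- the shape gaps G_k = ψ(h_k) − ψ(h′_k) ≥ 0, G_0 = 0, summed by parts against the fading profile
  have h0 : h' 0 = h 0 := by rw [hf.1, hf'.1]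
  have hG : ∀ k, 0 ≤ ψ (h k) - ψ (h' k) := fun k => sub_nonneg.mpr (hψmono _ _ (hh' k).1 (hle k) (hh k).2)
  have hG0 : ψ (h 0) - ψ (h' 0) = 0 := by rw [h0, sub_self]
  have hparts := sum_le_of_fading (g := fun k => ψ (h k) - ψ (h' k)) hL hfade hG hG0 K
  have hdrop' : B h - B h' ≤ L 1 * (ψ (h 1) - ψ (h' 1)) + d₁ :=
    (hdrop h h' hh hh' hle h0).trans (hparts.trans (by linarith))
  -- the shape weight of age one (vacuous when K ≤ 1: then the drop at the pin vanishes outright)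
  rcases Nat.lt_or_ge K 2 with hK | hK
  · have hzero : B h - B h' ≤ 0 := by
      refine (hdrop h h' hh hh' hle h0).trans ?_
      interval_cases K
      · simp
      · rw [sum_range_one, hG0, mul_zero]
    have : 0 ≤ η := by rw [hη_def]; linarith [hexc h' hh']
    linarith
  have hw1 : L 1 * (ψ (h 1) * h 1 ^ 2 / 2) ≤ 1 :=
    shape_weight_one_le_one hmono hL hb hlo hdom hψnn hψmono hψsub hy hh hf (mem_range.mpr (by omega))
  have hkey : L 1 * (ψ (h 1) - ψ (h' 1)) ≤ δ₁ := by
    calc L 1 * (ψ (h 1) - ψ (h' 1)) ≤ L 1 * (ψ (h 1) * h 1 ^ 2 / 2 * δ₁) := mul_le_mul_of_nonneg_left hG₁ (hL 1)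
      _ = L 1 * (ψ (h 1) * h 1 ^ 2 / 2) * δ₁ := by ring
      _ ≤ 1 * δ₁ := mul_le_mul_of_nonneg_right hw1 hδ₁0
      _ = δ₁ := one_mul _
  have : B h - B h' ≤ η := by linarith
  rw [hη_def] at this
  linarith

/-! ## §3 ENDs: fading shape memories compare at any size -/

/-- **FADING MEMORIES OF A SUB-HOMOGENEOUS SHAPE COMPARE AT ANY SIZE.**  `B` on ]0,γ] with floor `b > 0` and zeroth moment `M ≥ 0` (ANY size), in the class
`ρ(u_0) + Σ_{k<K} L_k·ψ(u_k)` in inequality form (dominated by the shape profile; differences dominating the profile's, dominated by them at fixed newest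
entry), `ψ ≥ 0` non-decreasing sub-homogeneous, `L ≥ 0` with **`L_{k+1} ≤ L_k` for every `k ≥ 1`** (everything else ARBITRARY); `B′` with zeroth moment
`M′ ≥ 0`, `B ≤ B′` on the box, ISOTONE excess; `h`, `h′` ANY box solutions of `B`, `B′` from one pin `p ∈ ]0,γ]`.  Then `h′ ≤ h` at EVERY scale. [folklore] -/
theorem le_of_isotone_excess_dom_fading_shape {p : ℝ}
    (hB : ∀ u u' : ℕ → ℝ, SeqBox γ u → SeqBox γ u' → ∀ D : ℝ, (∀ j, |u j - u' j| ≤ D) → |B u - B u'| ≤ M * D) (hM : 0 ≤ M)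
    (hL : ∀ k, 0 ≤ L k) (hb : 0 < b) (hlo : ∀ u, SeqBox γ u → b ≤ B u)
    (hdom : ∀ u, SeqBox γ u → ∑ k ∈ range K, L k * ψ (u k) ≤ B u)
    (hdrop : ∀ u u' : ℕ → ℝ, SeqBox γ u → SeqBox γ u' → (∀ j, u' j ≤ u j) → u' 0 = u 0 →
      B u - B u' ≤ ∑ k ∈ range K, L k * (ψ (u k) - ψ (u' k)))
    (hlow : ∀ u u' : ℕ → ℝ, SeqBox γ u → SeqBox γ u' → (∀ j, u' j ≤ u j) →
      ∑ k ∈ range K, L k * (ψ (u k) - ψ (u' k)) ≤ B u - B u')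
    (hψnn : ∀ x : ℝ, 0 < x → x ≤ γ → 0 ≤ ψ x) (hψmono : ∀ x x' : ℝ, 0 < x → x ≤ x' → x' ≤ γ → ψ x ≤ ψ x')
    (hψsub : ∀ s x : ℝ, 0 ≤ s → s ≤ 1 → 0 < x → x ≤ γ → s * ψ x ≤ ψ (s * x))
    (hfade : ∀ k, 1 ≤ k → L (k + 1) ≤ L k)
    (hB' : ∀ u u' : ℕ → ℝ, SeqBox γ u → SeqBox γ u' → ∀ D : ℝ, (∀ j, |u j - u' j| ≤ D) → |B' u - B' u'| ≤ M' * D) (hM' : 0 ≤ M')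
    (hexc : ∀ u, SeqBox γ u → B u ≤ B' u)
    (hDmono : ∀ u v : ℕ → ℝ, SeqBox γ u → SeqBox γ v → (∀ j, u j ≤ v j) → B' u - B u ≤ B' v - B v)
    (hp : 0 < p) (hpγ : p ≤ γ) (hh : SeqBox γ h) (hf : MemFlow B p h) (hh' : SeqBox γ h') (hf' : MemFlow B' p h') (j : ℕ) :
    h' j ≤ h j :=
  le_of_isotone_excess_of_step (mono_of_low_shape hL hψmono hlow) hB hM hb hlo hB' hM' hexc hDmono
    (fun _ hy _ _ _ hu hfu hu' hfu' hle => effective_le_of_family_le_at_fading_shape hL hb hlo hdom hdrop hlow hψnn hψmono hψsub hfade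
      hexc hDmono hy hu hfu hu' hfu' hle)
    hp hpγ hh hf hh' hf' j

/-- **THE FADING SHAPE MEMORY `B(u) = b + Σ_{k<K} L_k·ψ(u_k)` COMPARES AT ANY SIZE** (`b > 0`; `ψ ≥ 0` non-decreasing, sub-homogeneous and `Λ`-Lipschitz on
]0,γ]; `L ≥ 0` with `L_{k+1} ≤ L_k` for `k ≥ 1` — `L_0`, `L_1`, `K`, `Λ` and all sizes ARBITRARY): every `B′ ≥ B` with a zeroth moment and an ISOTONE excess
gives `h′ ≤ h` at every scale from every pin — (E59a) `le_of_isotone_excess_shape_profile` without the profile condition. [folklore] -/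
theorem le_of_isotone_excess_fading_shape {p : ℝ} (hL : ∀ k, 0 ≤ L k) (hb : 0 < b) (hΛ : 0 ≤ Λ)
    (hψnn : ∀ x : ℝ, 0 < x → x ≤ γ → 0 ≤ ψ x) (hψmono : ∀ x x' : ℝ, 0 < x → x ≤ x' → x' ≤ γ → ψ x ≤ ψ x')
    (hψsub : ∀ s x : ℝ, 0 ≤ s → s ≤ 1 → 0 < x → x ≤ γ → s * ψ x ≤ ψ (s * x))
    (hψlip : ∀ x x' : ℝ, 0 < x → x ≤ γ → 0 < x' → x' ≤ γ → |ψ x - ψ x'| ≤ Λ * |x - x'|)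
    (hfade : ∀ k, 1 ≤ k → L (k + 1) ≤ L k)
    (hB' : ∀ u u' : ℕ → ℝ, SeqBox γ u → SeqBox γ u' → ∀ D : ℝ, (∀ j, |u j - u' j| ≤ D) → |B' u - B' u'| ≤ M' * D) (hM' : 0 ≤ M')
    (hexc : ∀ u, SeqBox γ u → (fun w : ℕ → ℝ => b + ∑ k ∈ range K, L k * ψ (w k)) u ≤ B' u)
    (hDmono : ∀ u v : ℕ → ℝ, SeqBox γ u → SeqBox γ v → (∀ j, u j ≤ v j) →
      B' u - (fun w : ℕ → ℝ => b + ∑ k ∈ range K, L k * ψ (w k)) u ≤ B' v - (fun w : ℕ → ℝ => b + ∑ k ∈ range K, L k * ψ (w k)) v)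
    (hp : 0 < p) (hpγ : p ≤ γ) (hh : SeqBox γ h) (hf : MemFlow (fun w : ℕ → ℝ => b + ∑ k ∈ range K, L k * ψ (w k)) p h)
    (hh' : SeqBox γ h') (hf' : MemFlow B' p h') (j : ℕ) : h' j ≤ h j := by
  refine le_of_isotone_excess_dom_fading_shape (B := fun w : ℕ → ℝ => b + ∑ k ∈ range K, L k * ψ (w k)) (K := K)
    (shape_functional_zerothMoment hL hΛ hψlip) (mul_nonneg hΛ (sum_nonneg fun k _ => hL k)) hL hb (shape_functional_floor hL hψnn)
    ?_ ?_ ?_ hψnn hψmono hψsub hfade hB' hM' hexc hDmono hp hpγ hh hf hh' hf' j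
  · intro u _; linarith
  · intro u u' _ _ _ _
    rw [add_sub_add_left_eq_sub, ← sum_sub_distrib]
    exact le_of_eq (sum_congr rfl fun k _ => by ring)
  · intro u u' _ _ _
    rw [add_sub_add_left_eq_sub, ← sum_sub_distrib]
    exact le_of_eq (sum_congr rfl fun k _ => by ring)

/-- **SATURATING FADING MEMORIES COMPARE AT ANY SIZE**: `B(u) = b + Σ_{k<K} L_k·min(u_k, σ)` (`b, σ > 0`; `L ≥ 0` with `L_{k+1} ≤ L_k` for `k ≥ 1`; everything
else ARBITRARY) — (E59b) `le_of_isotone_excess_min_profile` ∕ `_min_window` without the profile condition. [folklore] -/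
theorem le_of_isotone_excess_fading_min {p : ℝ} (hL : ∀ k, 0 ≤ L k) (hb : 0 < b) (hσ : 0 < σ)
    (hfade : ∀ k, 1 ≤ k → L (k + 1) ≤ L k)
    (hB' : ∀ u u' : ℕ → ℝ, SeqBox γ u → SeqBox γ u' → ∀ D : ℝ, (∀ j, |u j - u' j| ≤ D) → |B' u - B' u'| ≤ M' * D) (hM' : 0 ≤ M')
    (hexc : ∀ u, SeqBox γ u → (fun w : ℕ → ℝ => b + ∑ k ∈ range K, L k * min (w k) σ) u ≤ B' u)
    (hDmono : ∀ u v : ℕ → ℝ, SeqBox γ u → SeqBox γ v → (∀ j, u j ≤ v j) →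
      B' u - (fun w : ℕ → ℝ => b + ∑ k ∈ range K, L k * min (w k) σ) u ≤ B' v - (fun w : ℕ → ℝ => b + ∑ k ∈ range K, L k * min (w k) σ) v)
    (hp : 0 < p) (hpγ : p ≤ γ) (hh : SeqBox γ h) (hf : MemFlow (fun w : ℕ → ℝ => b + ∑ k ∈ range K, L k * min (w k) σ) p h)
    (hh' : SeqBox γ h') (hf' : MemFlow B' p h') (j : ℕ) : h' j ≤ h j :=
  le_of_isotone_excess_fading_shape (ψ := fun x => min x σ) hL hb zero_le_one (min_shape_nonneg (γ := γ) hσ)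
    (min_shape_mono (γ := γ)) (min_shape_subhom (γ := γ) hσ.le) (min_shape_lipschitz (γ := γ)) hfade hB' hM' hexc hDmono hp hpγ hh hf hh' hf' j

end Summit.QuantumFields.BalabanUV.Beta.EriceRemainderEnclosureHistoryAutonomyComparisonFadingShape

end
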